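import Literature.AlgebraicGeometry.HodgeTheory.CMTypeFamiliesBlockDecomposition
import Literature.AlgebraicGeometry.Pohlmann1968.DivisorClassesCMAlgebra
import Literature.AlgebraicGeometry.Pohlmann1968.CMTypeRankCharactersNumberField
import Literature.AlgebraicGeometry.HodgeTheory.GeneralHodgeCMTypeOfCodimTwo
import Literature.AlgebraicGeometry.HodgeTheory.CrossProductTopClass
import Literature.AlgebraicGeometry.HodgeTheory.SupportedHodgeClassDescent
import Literature.AlgebraicGeometry.HodgeTheory.AbelianVarietyPullbackAlgebraicClasses
import Literature.AlgebraicGeometry.HodgeTheory.AlgebraicClassesExteriorProduct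
import Literature.AlgebraicGeometry.HodgeTheory.AlgebraicClassesCupAbelianVarietyDiagonal
import Literature.AlgebraicGeometry.HodgeTheory.LefschetzOneOneHolds
import Literature.AlgebraicGeometry.HodgeTheory.ComplexOrientationFamily
import Literature.AlgebraicGeometry.ComplexMultiplication.CMAbelianVarietyRealisedHolds
import Literature.AlgebraicGeometry.Milne1999.CMTypeSimpleIsogenyFactors
import Literature.AlgebraicGeometry.Milne1999.CMTypeSubquotients
import Literature.NumberTheory.NumberFields.CMFieldCompositum
import Literature.AlgebraicGeometry.Motives.ZarhinHodgeGroupAutC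
import HarnessLib

/-!
# The Hodge conjecture for products of CM abelian varieties over one Galois CM field follows from the Hodge
# conjecture in codimension two for CM abelian varieties (Hazama 2002/2003, Milne 2007 Thm. 8.5 — the product step)

Family `hodge`, layer `Literature/AlgebraicGeometry/HodgeTheory`. Theorems only (plus two small definitions with
bodies: the Galois twist `twist s₀ s` of an embedding and the EFFECTIVE TYPE `effType` of an eigen-index); no named
fact, no `sorry`. Consumer: `HodgeTheory/CMHodgeConjectureOfCodimTwo` (Milne's Thm. 8.5 for every CM abelian variety).

## The printed statement and its mechanism

J. S. Milne, *The Tate conjecture over finite fields (AIM talk)*, arXiv:0709.3040 [Milne2007TateFiniteFieldsAIM] §8.2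
(held `paper:arxiv-0709.3040` p0015–p0016), VERBATIM: "**Theorem 8.3.** Let `A = A(G,K,ρ)`. For every `n ≥ 0`, the
`ℚ`-algebra `𝓑*(Aⁿ)` is generated by the classes of degree `≤ 2`. Proof. See [hazama2003], 7." and "**Theorem 8.5.**
In order to prove the Hodge conjecture for CM abelian varieties over `ℂ`, it suffices to prove it in codimension `2`.
Proof. If the Hodge conjecture holds in codimension `2`, then Theorem 8.3 shows that it holds for the varieties
`A(G,K,ρ_Φ)ⁿ` …" (= F. Hazama, Publ. RIMS 39 (2003) [Hazama2003GHCCM], Thm. 7.14 "`A_{A(2ⁿ)}(G;K)` is … `2`-dominated",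
Thm. 8.2 p. 651, Thm. 8.3 p. 655; Proc. Japan Acad. 78A (2002) [Hazama2002GHCCM] Thm. 7.6).

`A(G,K,ρ)` is isogenous to the product of (powers of) CM abelian varieties of ALL CM types of the Galois CM field `K`
(Milne Prop. 8.2/8.4). This file proves the theorem that paragraph needs, for an ARBITRARY finite product
`B = ⨁_{i<n} A_i` of realisations `(A_i, ι_i, θ_i)` of CM types `Φ_i` of one Galois CM field `L`:

* **`hodgeConjectureFor_biproduct_of_codimTwo`** — if every complex abelian variety of CM-type satisfies the Hodge
  conjecture in codimension two (`∀ X, CMHodgeCodimTwoHypothesisAt X`, the hypothesis of Hazama's theorem as typed in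
  `GeneralHodgeCMTypeOfCodimTwo`), then `HodgeConjectureFor (⨁ A).dim (⨁ A).X`.

MECHANISM (Hazama's `2`-dominatedness in its correct, ℤ-linear form — Milne's literal "generated in degree `≤ 2`" is
refuted by Hazama's Remark 7.15, the tree's barrier `Barriers/HodgeConjecture/CMHodgeRingNotGeneratedInCodimensionTwo`).
By Pohlmann's theorem (`Pohlmann1968_thm1_cmAlgebra`, Hazama (4.C)/(4.1)) `Bᵐ(B) ⊗ ℂ` is spanned by the cup monomials
`w_S` of an eigenbasis over the BALANCED `2m`-subsets `S ⊆ ⊔_i Hom(L, ℂ)`. Fix such an `S`.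
1. (§1) `L` being Galois, each eigen-index `x = (i, s)`, `s = s₀ ∘ γ`, has an EFFECTIVE TYPE `Φ_i^γ` (`effType`), and
   Galois-balancedness of a set of indices is balancedness of the family of its effective types
   (`isGaloisBalancedAlg_iff_isBalancedOn`).
2. (`CMTypeFamiliesBlockDecomposition`) the family of effective types of `S`, enlarged by complementary pairs of new CM
   types `Θ'_y`, splits into balanced blocks of size `2`/`4`.
3. (§2–§3) Realise the `Θ'_y` by CM abelian varieties `A'_y` (`exists_isCMTypeRealisation`, Shimura §6.2 Thm. 3) and
   form the enlarged product `B'' = ⨁ (A ⊔ A')`; on `B''` the monomial over `S ⊔ (all indices of the new factors)` is a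
   product of monomials over balanced blocks of size `2`/`4`, i.e. of classes in `B¹ ⊗ ℂ` (algebraic by Lefschetz
   `(1,1)`, `lefschetzOneOne_rational_holds`) and `B² ⊗ ℂ` (algebraic by the HYPOTHESIS at the CM abelian variety `B''`),
   hence algebraic (`Nˡ ∪ Nᵏ ⊆ Nˡ⁺ᵏ` on an abelian variety: exterior product + pull-back along the diagonal,
   `map_mem_algebraicClasses_of_abelianVariety`).
4. (§3) Pull back along `φ : B × B' → B''` (`B' = ⨁ A'`): `φ^* w = ± pr_B^* w_S ∪ pr_{B'}^* Ω`, `Ω` the top monomial of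
   `B'`; CONTRACT with the Gysin map of `pr_B` (`pr_{B*}(pr_B^* a ∪ pr_{B'}^* Ω) = ε a`, `ε ≠ 0`: `complexGysin_cup`,
   `complexGysin_fst_map_snd_ne_zero_of_ne_zero`, `complexGysin_mem_algebraicClasses`): `w_S` is algebraic.

## References

* [Milne2007TateFiniteFieldsAIM] J. S. Milne, arXiv:0709.3040, §8.1 Plain 8.1, Prop. 8.2; §8.2 Thm. 8.3, Prop. 8.4,
  Thm. 8.5.
* [Hazama2003GHCCM] F. Hazama, Publ. RIMS 39 (2003) 625–655: (4.B)/(4.C)/(4.1) p. 631, (4.3) p. 634, Prop. 6.5 p. 644,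
  Thm. 7.14 and Remark 7.15 p. 650, Thm. 8.2 p. 651, Thm. 8.3 p. 655.
* [Hazama2002GHCCM] F. Hazama, Proc. Japan Acad. 78A (2002) 72–75, Thm. 7.6.
* [Pohlmann1968] H. Pohlmann, Ann. of Math. 88 (1968) 161–180, Thm. 1.
* [GaoUllmo2025] Z. Gao, E. Ullmo, J. Inst. Math. Jussieu 25 (2025), Thm. 3.1 (3.2).
* [Shimura1998] G. Shimura, *Abelian Varieties with Complex Multiplication and Modular Functions* (1998), §6.2 Thm. 3,
  §8.1, §18.2 Lemma.
* [VoisinHodgeII2003] C. Voisin, *Hodge Theory and Complex Algebraic Geometry II* (2003), Prop. 9.20, Prop. 9.21.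
* [FultonYoungTableaux1997] W. Fulton, *Young Tableaux* (1997), App. B §B.1 (5)–(6) (Gysin maps, projection formula).
* [HatcherAT2002] A. Hatcher, *Algebraic Topology* (2002), §3.2.
-/

noncomputable section

open scoped Classical
open CategoryTheory CategoryTheory.Limits MonoidalCategory CartesianMonoidalCategory NumberField
open NumberField.ComplexEmbedding (conjugate)

namespace Literature.AlgebraicGeometry.HodgeTheory

namespace CMCodimTwo

open Literature.AlgebraicTopology.SingularHomology
open Literature.AlgebraicGeometry.Motives (AbelianVariety CMType IsSmoothProjective ComplexPoints SchemeOver)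
open Literature.AlgebraicGeometry.ComplexMultiplication (IsCMTypeRealisation exists_isCMTypeRealisation)
open Literature.NumberTheory.NumberFields (exists_ringOfIntegers_separating_embeddings)
open Literature.AlgebraicGeometry.Pohlmann1968
open Literature.AlgebraicGeometry.VanGeemen1994 (hodgeClassSpan)
open Literature.NumberTheory.ComplexMultiplication (inducedCMType mem_inducedCMType_iff inducedCMType_id CMTypeOps.bar
  CMTypeOps.mem_bar_iff CMTypeOps.conjugate_mem_iff_notMem CMTypeOps.mem_iff_conjugate_notMem)
open CMTypeFamily (IsBalancedOn IsBlockUnion)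

/-! ### §0 Generic inputs on abelian varieties -/

section Generic

/-- **Contraction along a projection**: if `pr_A^* a ∪ pr_C^* ω` is algebraic on `A × C` for a NON-ZERO top-degree
class `ω` of `C`, then `a` is algebraic on `A` — the Gysin map `pr_{A*}` preserves algebraic classes
(`complexGysin_mem_algebraicClasses`) and `pr_{A*}(pr_A^* a ∪ pr_C^* ω) = a ∪ pr_{A*} pr_C^* ω = ε · a` with `ε ≠ 0`
(projection formula `complexGysin_cup`; `complexGysin_fst_map_snd_ne_zero_of_ne_zero`).
[cite: FultonYoungTableaux1997, Appendix B §B.1 (5)–(6)] [cite: VoisinHodgeII2003, Prop. 9.21 (ii)] -/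
theorem mem_algebraicClasses_of_cupProduct_map_fst_map_snd (A C : AbelianVariety ℂ) {p : ℕ}
    {a : complexBetti A.X (2 * p)} {ω : complexBetti C.X (2 * C.dim)} (hω : ω ≠ 0)
    (h : cupProduct (two_mul_add_two_mul p C.dim) (complexBetti.map (fst A.X C.X) (2 * p) a)
      (complexBetti.map (snd A.X C.X) (2 * C.dim) ω) ∈ algebraicClasses (A.X ⊗ C.X) (p + C.dim)) :
    a ∈ algebraicClasses A.X p := by
  have hA : IsSmoothProjective A.dim A.X := Motives.AbelianVariety.isSmoothProjective_holds
  have hC : IsSmoothProjective C.dim C.X := Motives.AbelianVariety.isSmoothProjective_holds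
  have hAC := Motives.IsSmoothProjective.tensor_holds hA hC
  set μ := complexOrientationFamily
  have hμ : μ.HasPoincareDuality := OrientationFamily.hasPoincareDuality μ
  -- `pr_{A*}` of the algebraic class is algebraic
  have halg := complexGysin_mem_algebraicClasses (gysinMap_restrictCompl_eq_zero_of_field ℂ) μ hμ hAC hA (fst A.X C.X)
    (q := p + C.dim) (p := p) (by omega) (by omega) h
  -- projection formula
  have hg := complexGysin_fst_map_snd_ne_zero_of_ne_zero μ hA hC hω
  set g := complexGysin μ hAC hA (fst A.X C.X) (show 2 * C.dim + 2 * A.dim = 0 + 2 * (A.dim + C.dim) by omega)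
    (complexBetti.map (snd A.X C.X) (2 * C.dim) ω) with hgdef
  obtain ⟨ε, hε⟩ := exists_eq_smul_one μ hA g
  have hε0 : ε ≠ 0 := fun h0 ↦ hg (by rw [hε, h0, zero_smul])
  have hproj := complexGysin_cup hμ hAC hA (fst A.X C.X) (two_mul_add_two_mul p C.dim)
    (show 2 * (p + C.dim) + 2 * A.dim = 2 * p + 2 * (A.dim + C.dim) by omega)
    (show 2 * C.dim + 2 * A.dim = 0 + 2 * (A.dim + C.dim) by omega) (Nat.add_zero (2 * p)) a
    (complexBetti.map (snd A.X C.X) (2 * C.dim) ω)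
  rw [← hgdef, hε, map_smul, cupProduct_one] at hproj
  rw [hproj] at halg
  have : ε⁻¹ • ε • a ∈ algebraicClasses A.X p := Submodule.smul_mem _ _ halg
  rwa [smul_smul, inv_mul_cancel₀ hε0, one_smul] at this

/-- `B¹(A) ⊗ ℂ ⊆ N¹ H²` on an abelian variety (Lefschetz `(1,1)`, the tree's theorem `lefschetzOneOne_rational_holds`):
the span of the rational `(1,1)`-classes consists of algebraic classes. [cite: VoisinHodgeI2002, §11.3 Thm. 11.30 (Lefschetz (1,1))] -/
theorem hodgeClassSpan_one_le_algebraicClasses (A : AbelianVariety ℂ) :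
    hodgeClassSpan A.dim A.X 1 ≤ algebraicClasses A.X 1 :=
  Submodule.span_le.2 fun _ ⟨hcQ, hcH⟩ =>
    lefschetzOneOne_rational_holds Motives.AbelianVariety.isSmoothProjective_holds _ hcQ hcH

/-- `B²(A) ⊗ ℂ ⊆ N² H⁴` on an abelian variety of CM-type, GIVEN the Hodge conjecture in codimension two for CM
abelian varieties (Hazama's hypothesis `CMHodgeCodimTwoHypothesisAt`, at `A`).
[cite: Hazama2003GHCCM, Thm. 8.3 p. 655 (hypothesis)] [cite: Milne2007TateFiniteFieldsAIM, Thm. 8.5 (hypothesis)] -/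
theorem hodgeClassSpan_two_le_algebraicClasses_of_codimTwo {A : AbelianVariety ℂ}
    (h2 : CMHodgeCodimTwoHypothesisAt A) (hCM : Milne1999.IsOfCMType A) :
    hodgeClassSpan A.dim A.X 2 ≤ algebraicClasses A.X 2 :=
  Submodule.span_le.2 fun _ ⟨hcQ, hcH⟩ => h2 Motives.AbelianVariety.isSmoothProjective_holds hCM _ hcQ hcH

/-! #### Cup monomials: reindexing up to sign, pull-back, disjoint unions in a prescribed degree -/

variable {Y : Type} [TopologicalSpace Y] {I : Type} [LinearOrder I]

/-- **A cup product of degree-one classes enumerated injectively is `±` the cup monomial of its image**: for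
`f : Fin d → I` injective with image the `d`-set `s`, `v_{f 0} ⌣ ⋯ ⌣ v_{f (d-1)} = sign(π) · v_s` (the iterated cup
product is alternating, `cupPowOneAlt`; `π` sorts `f`). [cite: HatcherAT2002, §3.2 Example 3.16] -/
theorem exists_cupPowOne_comp_eq_smul_cupMonomial (v : I → singularCohomology ℂ ℂ Y 1) {d : ℕ} (f : Fin d → I)
    (hf : Function.Injective f) (s : Set.powersetCard I d) (hs : (s : Finset I) = Finset.univ.image f) :
    ∃ ε : ℤˣ, cupPowOne ℂ Y d (v ∘ f) = ε • cupMonomial v d s := by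
  let g : Fin d ↪o I := Set.powersetCard.ofFinEmbEquiv.symm s
  have hmem : ∀ k, f k ∈ Set.range g := fun k => by
    rw [Set.powersetCard.mem_range_ofFinEmbEquiv_symm_iff_mem, ← Set.powersetCard.mem_coe_iff, hs]
    exact Finset.mem_image_of_mem f (Finset.mem_univ k)
  choose σ hσ using hmem
  have hσinj : Function.Injective σ := fun k k' hk => hf (by rw [← hσ k, ← hσ k', hk])
  let τ : Equiv.Perm (Fin d) := Equiv.ofBijective σ hσinj.bijective_of_finite
  have hvf : v ∘ f = (v ∘ g) ∘ τ := by
    funext k; simp only [Function.comp_apply, τ, Equiv.ofBijective_apply, hσ]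
  refine ⟨Equiv.Perm.sign τ, ?_⟩
  rw [hvf, ← cupPowOneAlt_apply, AlternatingMap.map_perm, cupPowOneAlt_apply]
  rfl

/-- **Disjoint union of cup monomials in a prescribed degree**: if `(T : Finset I) = s ⊔ t` (disjoint, `|s| = m`,
`|t| = n`, `m + n = N`), then `v_T = ± (v_s ⌣ v_t)` in `H^N`. [cite: HatcherAT2002, §3.2 Example 3.16] -/
theorem exists_cupMonomial_eq_smul_cupProduct (v : I → singularCohomology ℂ ℂ Y 1) {m n N : ℕ} (h : m + n = N)
    (s : Set.powersetCard I m) (t : Set.powersetCard I n) (hst : Disjoint s.val t.val) (T : Set.powersetCard I N)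
    (hT : (T : Finset I) = s.val.disjUnion t.val hst) :
    ∃ ε : ℤˣ, cupMonomial v N T = ε • cupProduct h (cupMonomial v m s) (cupMonomial v n t) := by
  subst h
  have hT' : T = Set.powersetCard.disjUnion hst := Subtype.ext hT
  subst hT'
  exact ⟨_, cupMonomial_disjUnion_eq_smul_cup v s t hst⟩

/-- A `ℤˣ`-multiple of a member of a `ℂ`-submodule is a member. [folklore] -/
private theorem units_smul_mem {M : Type*} [AddCommGroup M] [Module ℂ M] (N : Submodule ℂ M) (ε : ℤˣ) {x : M}
    (hx : x ∈ N) : ε • x ∈ N := by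
  rw [Units.smul_def]; exact N.smul_of_tower_mem _ hx

/-- Membership of `x` from membership of a `ℤˣ`-multiple. [folklore] -/
private theorem mem_of_units_smul_mem {M : Type*} [AddCommGroup M] [Module ℂ M] (N : Submodule ℂ M) (ε : ℤˣ) {x : M}
    (hx : ε • x ∈ N) : x ∈ N := by
  have := units_smul_mem N ε⁻¹ hx
  rwa [smul_smul, inv_mul_cancel, one_smul] at this

/-- A `ℤˣ`-multiple is the corresponding complex multiple. [folklore] -/
private theorem units_smul_eq_cast_smul {M : Type*} [AddCommGroup M] [Module ℂ M] (ε : ℤˣ) (x : M) :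
    ε • x = ((ε : ℤ) : ℂ) • x := by
  rw [Units.smul_def, ← Int.cast_smul_eq_zsmul ℂ]

/-- **Re-indexing a cup monomial along an injection of index sets, up to sign**: if `s' = e(s)` for an injection
`e : I ↪ I'` of linearly ordered index sets (not necessarily monotone), then `u_{s'} = ± (u ∘ e)_s`.
[cite: HatcherAT2002, §3.2 Example 3.16] -/
theorem exists_cupMonomial_map_eq_smul {I' : Type} [LinearOrder I'] (u : I' → singularCohomology ℂ ℂ Y 1)
    (e : I ↪ I') {d : ℕ} (s : Set.powersetCard I d) (s' : Set.powersetCard I' d)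
    (hs' : (s' : Finset I') = (s : Finset I).map e) :
    ∃ ε : ℤˣ, cupMonomial u d s' = ε • cupMonomial (u ∘ e) d s := by
  let g : Fin d ↪o I' := Set.powersetCard.ofFinEmbEquiv.symm s'
  have hmem : ∀ j, ∃ x ∈ (s : Finset I), e x = g j := fun j => by
    have hj : g j ∈ (s' : Finset I') := by
      rw [Set.powersetCard.mem_coe_iff, ← Set.powersetCard.mem_range_ofFinEmbEquiv_symm_iff_mem]
      exact ⟨j, rfl⟩
    rw [hs'] at hj
    exact Finset.mem_map.1 hj
  choose f hf hef using hmem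
  have hfinj : Function.Injective f := fun j j' h => g.injective (by rw [← hef j, ← hef j', h])
  have hfs : (s : Finset I) = Finset.univ.image f := by
    symm
    apply Finset.eq_of_subset_of_card_le
    · intro x hx
      obtain ⟨j, -, rfl⟩ := Finset.mem_image.1 hx
      exact hf j
    · rw [Finset.card_image_of_injective _ hfinj, Finset.card_univ, Fintype.card_fin]
      exact (Set.powersetCard.mem_iff.1 s.2).le
  obtain ⟨ε, hε⟩ := exists_cupPowOne_comp_eq_smul_cupMonomial (u ∘ e) f hfinj s hfs
  refine ⟨ε, ?_⟩
  rw [← hε, cupMonomial_eq]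
  congr 1
  funext j
  simp only [Function.comp_apply, hef]
  rfl

/-- **Pull-back of a cup monomial**: `f^* (v_s) = (f^* ∘ v)_s` (naturality of the iterated cup product,
`complexBetti_map_cupPowOne`). [cite: HatcherAT2002, §3.2 Prop. 3.10] -/
theorem complexBetti_map_cupMonomial {X X' : SchemeOver ℂ} (f : X ⟶ X') {J : Type} [LinearOrder J]
    (v : J → complexBetti X' 1) (d : ℕ) (s : Set.powersetCard J d) :
    complexBetti.map f d (cupMonomial v d s) = cupMonomial (fun i => complexBetti.map f 1 (v i)) d s := by
  rw [cupMonomial_eq, cupMonomial_eq, Motives.complexBetti_map_cupPowOne]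

end Generic

/-! ### §1 Effective types of eigen-indices over one Galois CM field -/

section EffType

variable {L : Type} [Field L] [NumberField L] [IsGalois ℚ L]

/-- **The Galois twist of an embedding**: for `L/ℚ` Galois and embeddings `s₀, s : L → ℂ`, the automorphism `γ` of `L`
with `s = s₀ ∘ γ` (Shimura §8.1: the embeddings of a Galois CM field are `σ₀ ∘ g`, `g ∈ Gal(L/ℚ)`; the tree's
`exists_algEquiv_comp_eq`). [cite: Shimura1998, §8.1] -/
def twist (s₀ s : L →+* ℂ) : L ≃ₐ[ℚ] L := Classical.choose (exists_algEquiv_comp_eq s₀ s)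

/-- `s₀ (twist s₀ s x) = s x`. [cite: Shimura1998, §8.1] -/
theorem apply_twist (s₀ s : L →+* ℂ) (x : L) : s₀ (twist s₀ s x) = s x := Classical.choose_spec (exists_algEquiv_comp_eq s₀ s) x

/-- `s₀ ∘ twist s₀ s = s` as ring homomorphisms. [cite: Shimura1998, §8.1] -/
theorem comp_twist (s₀ s : L →+* ℂ) : s₀.comp (twist s₀ s : L →+* L) = s := RingHom.ext fun x => apply_twist s₀ s x

/-- `twist s₀ s₀ = 1`. [cite: Shimura1998, §8.1] -/
theorem twist_self (s₀ : L →+* ℂ) : twist s₀ s₀ = 1 :=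
  AlgEquiv.ext fun x => s₀.injective (by rw [apply_twist]; rfl)

variable {n : ℕ} (Φ : Fin n → CMType L) (s₀ : L →+* ℂ)

/-- **The effective type of the eigen-index `x = (i, s)`** of a product `⨁_{i<n} A_i` of CM abelian varieties of CM
types `Φ_i` of the Galois CM field `L`, relative to the base embedding `s₀`: the CM type `Φ_i^γ = {σ | σ ∘ γ ∈ Φ_i}`
with `s = s₀ ∘ γ` — the CM type `Θ` such that, for every automorphism `τ` of `ℂ`, `τ ∘ s ∈ Φ_i ↔ τ ∘ s₀ ∈ Θ`; in
Hazama's coordinates (4.B)/(4.C), the `G`-translate `S₁ g` seen from the base point. [cite: Hazama2003GHCCM, (4.B)/(4.C) p. 631] [cite: Shimura1998, §8.1] -/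
def effType (x : (_ : Fin n) × (L →+* ℂ)) : CMType L := inducedCMType (twist s₀ x.2 : L →+* L) (Φ x.1)

/-- Membership in the effective type: `σ ∈ effType x ↔ σ ∘ γ_x ∈ Φ_{x.1}`. [cite: Hazama2003GHCCM, (4.C) p. 631] -/
theorem mem_effType_iff (x : (_ : Fin n) × (L →+* ℂ)) (σ : L →+* ℂ) :
    σ ∈ (effType Φ s₀ x).1 ↔ σ.comp (twist s₀ x.2 : L →+* L) ∈ (Φ x.1).1 :=
  mem_inducedCMType_iff _ _ _

/-- The key identity: for `τ ∈ Aut(ℂ)`, `τ ∘ s ∈ Φ_i ↔ τ ∘ s₀ ∈ effType (i, s)` (`(τ ∘ s₀) ∘ γ = τ ∘ s`).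
[cite: Hazama2003GHCCM, (4.C)/(4.1) p. 631] [cite: Shimura1998, §8.1] -/
theorem comp_mem_iff_comp_base_mem_effType (τ : ℂ ≃+* ℂ) (x : (_ : Fin n) × (L →+* ℂ)) :
    (τ : ℂ →+* ℂ).comp x.2 ∈ (Φ x.1).1 ↔ (τ : ℂ →+* ℂ).comp s₀ ∈ (effType Φ s₀ x).1 := by
  rw [mem_effType_iff, RingHom.comp_assoc, comp_twist]

/-- At the base embedding the effective type is the type itself: `effType (i, s₀) = Φ_i`. [cite: Hazama2003GHCCM, (4.B) p. 631] -/
theorem effType_base (i : Fin n) : effType Φ s₀ ⟨i, s₀⟩ = Φ i := by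
  apply Subtype.ext; ext σ
  rw [mem_effType_iff, twist_self]
  change σ.comp (RingHom.id L) ∈ (Φ i).1 ↔ σ ∈ (Φ i).1
  rw [RingHom.comp_id]

/-- A number field is countable. [folklore] -/
private theorem countable_L : Countable L := Countable.of_equiv _ (Module.finBasis ℚ L).equivFun.toEquiv.symm

/-- **Galois-balanced = balanced family of effective types**: for a finite set `T` of eigen-indices of `⨁ A_i`,
Pohlmann's / Gao–Ullmo's condition (3.2) over `Aut(ℂ)` (`IsGaloisBalancedAlg`) is the balancedness of the family of
effective types on `T` (`CMTypeFamily.IsBalancedOn`): every `τ ∈ Aut(ℂ)` is read at `σ = τ ∘ s₀`, and every `σ` arises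
(`Aut(ℂ)` is transitive on the embeddings of `L`). [cite: Hazama2003GHCCM, (4.C)/(4.1) p. 631] [cite: GaoUllmo2025, Thm. 3.1 (3.2)] -/
theorem isGaloisBalancedAlg_iff_isBalancedOn (T : Finset ((_ : Fin n) × (L →+* ℂ))) :
    IsGaloisBalancedAlg (K := fun _ => L) Φ T ↔ IsBalancedOn (effType Φ s₀) T := by
  have key₁ : ∀ τ : ℂ ≃+* ℂ,
      {x | x ∈ T ∧ (τ : ℂ →+* ℂ).comp x.2 ∈ (Φ x.1).1}.ncard =
        (T.filter fun x => (τ : ℂ →+* ℂ).comp s₀ ∈ (effType Φ s₀ x).1).card := by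
    intro τ
    rw [← Set.ncard_coe_finset, Finset.coe_filter]
    congr 1
    ext x
    simp only [Set.mem_setOf_eq, comp_mem_iff_comp_base_mem_effType Φ s₀ τ x]
  have key₂ : ∀ τ : ℂ ≃+* ℂ,
      {x | x ∈ T ∧ (τ : ℂ →+* ℂ).comp x.2 ∉ (Φ x.1).1}.ncard =
        (T.filter fun x => (τ : ℂ →+* ℂ).comp s₀ ∉ (effType Φ s₀ x).1).card := by
    intro τ
    rw [← Set.ncard_coe_finset, Finset.coe_filter]
    congr 1
    ext x
    simp only [Set.mem_setOf_eq, comp_mem_iff_comp_base_mem_effType Φ s₀ τ x]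
  constructor
  · intro h σ
    haveI := countable_L (L := L)
    obtain ⟨τ, hτ⟩ := Motives.ZarhinLie.exists_ringEquiv_complex_comp_eq s₀ σ
    have hτ' : (τ : ℂ →+* ℂ).comp s₀ = σ := RingHom.ext hτ
    have h1 := h τ
    rw [key₁ τ, key₂ τ, hτ'] at h1
    exact h1
  · intro h τ
    have h1 := h ((τ : ℂ →+* ℂ).comp s₀)
    rw [← key₁ τ, ← key₂ τ] at h1
    exact h1

end EffType

/-! ### §2 Block unions of eigen-indices give algebraic cup monomials -/

section Blocks

variable {L : Type} [Field L] [NumberField L] [IsGalois ℚ L]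
variable {n : ℕ} {Φ : Fin n → CMType L} {A : Fin n → AbelianVariety ℂ} {ι : ∀ i : Fin n, 𝓞 L →+* End (A i)}
  {θ : ∀ i : Fin n, L →+* Module.End ℂ (complexBetti (A i).X 1)}

/-- **A balanced block gives a class in `Bʲ ⊗ ℂ`**: for a `2j`-set `S` of eigen-indices whose family of effective types
is balanced, the cup monomial `w_S` of an eigenbasis lies in `hodgeClassSpan _ _ j` (it spans the weight space
`H^{2j}(B)_S`, which lies in `Bʲ ⊗ ℂ` by Pohlmann's theorem `Pohlmann1968_thm1_cmAlgebra`, `⊇`).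
[cite: Pohlmann1968, Thm. 1] [cite: GaoUllmo2025, Thm. 3.1] [cite: Hazama2003GHCCM, (4.C)/(4.1) p. 631] -/
theorem cupMonomial_mem_hodgeClassSpan_of_isBalancedOn (hA : ∀ i, IsCMTypeRealisation (Φ i) (A i) (ι i) (θ i))
    (s₀ : L →+* ℂ) [LinearOrder ((_ : Fin n) × (L →+* ℂ))]
    {w : Module.Basis ((_ : Fin n) × (L →+* ℂ)) ℂ (complexBetti (⨁ A).X 1)}
    (hw : ∀ (c : Fin n → 𝓞 L) (x : (_ : Fin n) × (L →+* ℂ)),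
      complexBetti.map (biproduct.map fun i => ι i (c i)).hom.hom.hom 1 (w x) = x.2 ((c x.1 : 𝓞 L) : L) • w x)
    {j : ℕ} (S : Set.powersetCard ((_ : Fin n) × (L →+* ℂ)) (2 * j)) (hS : IsBalancedOn (effType Φ s₀) (S : Finset _)) :
    cupMonomial w (2 * j) S ∈ hodgeClassSpan (⨁ A).dim (⨁ A).X j := by
  obtain ⟨b, hb⟩ := exists_monomialBasis w (2 * j)
  have hb' : ∀ s, b s = cupMonomial w (2 * j) s := hb
  have hmem : (S : Finset _) ∈ pohlmannSetsAlg (K := fun _ => L) Φ j :=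
    ⟨S.2, (isGaloisBalancedAlg_iff_isBalancedOn Φ s₀ _).2 hS⟩
  have hle := weightClassesAlg_le_hodgeClassSpan (K := fun _ => L) (A := A) (Φ := Φ) (ι := ι) (θ := θ) hA hmem
  rw [weightClassesAlg_eq_span_singleton (K := fun _ => L) hw hb' S] at hle
  rw [← hb' S]
  exact hle (Submodule.mem_span_singleton_self _)

/-- **A block union of eigen-indices gives an ALGEBRAIC cup monomial, granted the Hodge conjecture in codimension two
for CM abelian varieties**: `w_T ∈ Nᵖ H²ᵖ(B)` for `T` a disjoint union of balanced blocks of size `2` (classes in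
`B¹ ⊗ ℂ`, algebraic by Lefschetz `(1,1)`) or `4` (classes in `B² ⊗ ℂ`, algebraic by hypothesis at the CM abelian variety
`B = ⨁ A_i`), products of algebraic classes being algebraic on an abelian variety — the index-set form of "`𝓑*` is
spanned by products of classes of degree `≤ 2`". [cite: Hazama2003GHCCM, Thm. 7.14 p. 650 and Thm. 8.2 p. 651]
[cite: Milne2007TateFiniteFieldsAIM, Thm. 8.3 and proof of Thm. 8.5] -/
theorem cupMonomial_mem_algebraicClasses_of_isBlockUnion
    (hA : ∀ i, IsCMTypeRealisation (Φ i) (A i) (ι i) (θ i)) (hCM : Milne1999.IsOfCMType (⨁ A))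
    (h2 : CMHodgeCodimTwoHypothesisAt (⨁ A)) (s₀ : L →+* ℂ) [LinearOrder ((_ : Fin n) × (L →+* ℂ))]
    {w : Module.Basis ((_ : Fin n) × (L →+* ℂ)) ℂ (complexBetti (⨁ A).X 1)}
    (hw : ∀ (c : Fin n → 𝓞 L) (x : (_ : Fin n) × (L →+* ℂ)),
      complexBetti.map (biproduct.map fun i => ι i (c i)).hom.hom.hom 1 (w x) = x.2 ((c x.1 : 𝓞 L) : L) • w x)
    {T₀ : Finset ((_ : Fin n) × (L →+* ℂ))} (hT₀ : IsBlockUnion (effType Φ s₀) T₀) :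
    ∀ (p : ℕ) (T : Set.powersetCard ((_ : Fin n) × (L →+* ℂ)) (2 * p)), (T : Finset _) = T₀ →
      cupMonomial w (2 * p) T ∈ algebraicClasses (⨁ A).X p := by
  induction hT₀ with
  | empty =>
    intro p T hT
    have hp : 2 * p = 0 := by rw [← T.2, hT, Finset.card_empty]
    obtain rfl : p = 0 := by omega
    rw [algebraicClasses_zero]; exact Submodule.mem_top
  | @cons B T₁ hT₁ hdisj hcard hbal ih =>
    intro p T hT
    -- `|B| = 2j`, `j ∈ {1, 2}`
    obtain ⟨j, hj, hBj⟩ : ∃ j, (j = 1 ∨ j = 2) ∧ B.card = 2 * j := by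
      rcases hcard with h | h
      · exact ⟨1, Or.inl rfl, h⟩
      · exact ⟨2, Or.inr rfl, h⟩
    have hT₁card : T₁.card = 2 * p - 2 * j := by
      have h := T.2; rw [Set.powersetCard.mem_iff, hT, Finset.card_disjUnion] at h; omega
    have hjp : j ≤ p := by
      have h := T.2; rw [Set.powersetCard.mem_iff, hT, Finset.card_disjUnion] at h; omega
    obtain ⟨m₀, rfl⟩ : ∃ m₀, p = j + m₀ := ⟨p - j, by omega⟩
    let B' : Set.powersetCard ((_ : Fin n) × (L →+* ℂ)) (2 * j) := Set.powersetCard.ofCard hBj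
    let T₁' : Set.powersetCard ((_ : Fin n) × (L →+* ℂ)) (2 * m₀) := Set.powersetCard.ofCard (by rw [hT₁card]; omega)
    have hB'alg : cupMonomial w (2 * j) B' ∈ algebraicClasses (⨁ A).X j := by
      have hspan := cupMonomial_mem_hodgeClassSpan_of_isBalancedOn hA s₀ hw B' hbal
      rcases hj with rfl | rfl
      · exact hodgeClassSpan_one_le_algebraicClasses (⨁ A) hspan
      · exact hodgeClassSpan_two_le_algebraicClasses_of_codimTwo h2 hCM hspan
    have hT₁'alg : cupMonomial w (2 * m₀) T₁' ∈ algebraicClasses (⨁ A).X m₀ := ih m₀ T₁' rfl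
    obtain ⟨ε, hε⟩ := exists_cupMonomial_eq_smul_cupProduct (w : _ → complexBetti (⨁ A).X 1)
      (two_mul_add_two_mul j m₀) B' T₁' hdisj T hT
    rw [hε]
    exact units_smul_mem _ ε (AbelianVariety.cupProduct_mem_algebraicClasses (⨁ A) hB'alg hT₁'alg)

end Blocks

/-! ### §3 Gluing in auxiliary CM factors

The enlarged product `B'' = ⨁ (A ⊔ A')` is indexed by `Fin (n + k) ≃ Fin n ⊕ Fin k` (`finSumFinEquiv`); all glued data
are defined through `Sum.elim` / `Sum.rec` on `Fin n ⊕ Fin k` and composed with `finSumFinEquiv.symm`, so that no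
transport along `Fin.castAdd` / `Fin.natAdd` identities is needed. -/

section GlueIndex

variable {L : Type} [Field L] {n k : ℕ}

/-- The index in `⨁ (A ⊔ A')` of the eigen-index `x = (i, s)` of `B = ⨁_{i<n} A_i`. [folklore] -/
def inO (k : ℕ) (x : (_ : Fin n) × (L →+* ℂ)) : (_ : Fin (n + k)) × (L →+* ℂ) := ⟨finSumFinEquiv (Sum.inl x.1), x.2⟩

/-- The index in `⨁ (A ⊔ A')` of the eigen-index `z = (y, s)` of the auxiliary product `B' = ⨁_{y<k} A'_y`. [folklore] -/
def inN (n : ℕ) (z : (_ : Fin k) × (L →+* ℂ)) : (_ : Fin (n + k)) × (L →+* ℂ) := ⟨finSumFinEquiv (Sum.inr z.1), z.2⟩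

/-- `inO` is injective. [folklore] -/
private theorem inO_injective (k : ℕ) : Function.Injective (inO (n := n) (L := L) k) := by
  rintro ⟨i, s⟩ ⟨i', s'⟩ h
  have h1 : i = i' := Sum.inl_injective (finSumFinEquiv.injective (congrArg Sigma.fst h))
  have h2 : s = s' := congrArg (fun z : (_ : Fin (n + k)) × (L →+* ℂ) => z.2) h
  subst h1 h2
  rfl

/-- `inN` is injective. [folklore] -/
private theorem inN_injective (n : ℕ) : Function.Injective (inN (k := k) (L := L) n) := by
  rintro ⟨y, s⟩ ⟨y', s'⟩ h
  have h1 : y = y' := Sum.inr_injective (finSumFinEquiv.injective (congrArg Sigma.fst h))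
  have h2 : s = s' := congrArg (fun z : (_ : Fin (n + k)) × (L →+* ℂ) => z.2) h
  subst h1 h2
  rfl

/-- Old and new indices are distinct. [folklore] -/
private theorem inO_ne_inN (x : (_ : Fin n) × (L →+* ℂ)) (z : (_ : Fin k) × (L →+* ℂ)) : inO k x ≠ inN n z := fun h =>
  Sum.inl_ne_inr (finSumFinEquiv.injective (congrArg Sigma.fst h))

/-- `inO` as an embedding. [folklore] -/
def embO (k : ℕ) : ((_ : Fin n) × (L →+* ℂ)) ↪ ((_ : Fin (n + k)) × (L →+* ℂ)) := ⟨inO k, inO_injective k⟩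

/-- `inN` as an embedding. [folklore] -/
def embN (n : ℕ) : ((_ : Fin k) × (L →+* ℂ)) ↪ ((_ : Fin (n + k)) × (L →+* ℂ)) := ⟨inN n, inN_injective n⟩

/-- The images of old and of new indices are disjoint. [folklore] -/
private theorem disjoint_map_embO_map_embN (S : Finset ((_ : Fin n) × (L →+* ℂ))) (T : Finset ((_ : Fin k) × (L →+* ℂ))) :
    Disjoint (S.map (embO k)) (T.map (embN n)) := by
  rw [Finset.disjoint_left]
  intro z hz hz'
  obtain ⟨x, -, rfl⟩ := Finset.mem_map.1 hz
  obtain ⟨y, -, h⟩ := Finset.mem_map.1 hz'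
  exact inO_ne_inN x y h.symm

variable (Φ : Fin n → CMType L) (Θ' : Fin k → CMType L)

/-- The glued family of CM types `Φ ⊔ Θ'` on `Fin (n + k)`. [folklore] -/
def glueType : Fin (n + k) → CMType L := fun j => Sum.elim Φ Θ' (finSumFinEquiv.symm j)

/-- `(Φ ⊔ Θ')` at an old index. [folklore] -/
@[simp] private theorem glueType_inl (i : Fin n) : glueType Φ Θ' (finSumFinEquiv (Sum.inl i)) = Φ i := by
  simp [glueType]

/-- `(Φ ⊔ Θ')` at a new index. [folklore] -/
@[simp] private theorem glueType_inr (y : Fin k) : glueType Φ Θ' (finSumFinEquiv (Sum.inr y)) = Θ' y := by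
  simp [glueType]

variable [NumberField L] [IsGalois ℚ L] (s₀ : L →+* ℂ)

/-- `twist s₀ s₀` is the identity ring homomorphism. [cite: Shimura1998, §8.1] -/
theorem coe_twist_self : ((twist s₀ s₀ : L ≃ₐ[ℚ] L) : L →+* L) = RingHom.id L := by
  rw [twist_self]; rfl

/-- The effective type of an old index in the glued family is its effective type in the old family.
[cite: Hazama2003GHCCM, (4.B)/(4.C) p. 631] -/
theorem effType_glue_inO (x : (_ : Fin n) × (L →+* ℂ)) : effType (glueType Φ Θ') s₀ (inO k x) = effType Φ s₀ x := by
  simp only [effType, inO, glueType_inl]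

/-- The effective type of a new index `(y, σ)` in the glued family is `(Θ'_y)^γ`, `σ = s₀ ∘ γ`.
[cite: Hazama2003GHCCM, (4.B)/(4.C) p. 631] -/
theorem effType_glue_inN (y : Fin k) (σ : L →+* ℂ) :
    effType (glueType Φ Θ') s₀ (inN n ⟨y, σ⟩) = inducedCMType (twist s₀ σ : L →+* L) (Θ' y) := by
  simp only [effType, inN, glueType_inr]

/-- For a CM field `L` (complex conjugation `c` of `L` commutes with every embedding, Mathlib
`IsCMField.complexEmbedding_complexConj`): `τ ∘ σ̄ = \overline{τ ∘ σ}` for every ring endomorphism `τ` of `ℂ`.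
[cite: Shimura1998, §18.2 Lemma] -/
theorem comp_conjugate_eq [IsCMField L] (τ : ℂ →+* ℂ) (σ : L →+* ℂ) :
    τ.comp (conjugate σ) = conjugate (τ.comp σ) := by
  ext x
  rw [RingHom.comp_apply, NumberField.ComplexEmbedding.conjugate_coe_eq σ x,
    NumberField.ComplexEmbedding.conjugate_coe_eq (τ.comp σ) x,
    ← IsCMField.complexEmbedding_complexConj (K := L) σ x,
    ← IsCMField.complexEmbedding_complexConj (K := L) (τ.comp σ) x]
  rfl

omit [NumberField L] [IsGalois ℚ L] in
/-- An embedding of a field carrying a CM type is not self-conjugate. [folklore] -/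
private theorem conjugate_ne_self' (Ψ : CMType L) (σ : L →+* ℂ) : conjugate σ ≠ σ := fun h => by
  have h1 := CMTypeOps.conjugate_mem_iff_notMem Ψ σ
  rw [h] at h1
  exact iff_not_self h1

/-- **Conjugate eigen-indices of one factor have complementary effective types** (over a Galois CM field):
`effType (j, σ̄) = \overline{effType (j, σ)}`. [cite: Hazama2003GHCCM, (4.C) p. 631 and Thm. 7.13 (`d_a`)] -/
theorem effType_conjugate_eq_bar [IsCMField L] (j : Fin n) (σ : L →+* ℂ) :
    effType Φ s₀ ⟨j, conjugate σ⟩ = CMTypeOps.bar (effType Φ s₀ ⟨j, σ⟩) := by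
  apply Subtype.ext; ext ρ
  haveI := countable_L (L := L)
  obtain ⟨τ, hτ⟩ := Motives.ZarhinLie.exists_ringEquiv_complex_comp_eq s₀ ρ
  have hτ' : (τ : ℂ →+* ℂ).comp s₀ = ρ := RingHom.ext hτ
  rw [CMTypeOps.mem_bar_iff, ← hτ', ← comp_mem_iff_comp_base_mem_effType, ← comp_mem_iff_comp_base_mem_effType]
  change (τ : ℂ →+* ℂ).comp (conjugate σ) ∈ (Φ j).1 ↔ (τ : ℂ →+* ℂ).comp σ ∉ (Φ j).1
  rw [comp_conjugate_eq, CMTypeOps.conjugate_mem_iff_notMem]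

/-- A conjugate pair of eigen-indices of one factor is a balanced block of size `2` (a divisor class, Hazama's
`d_a`). [cite: Hazama2003GHCCM, Thm. 7.13 p. 650] -/
theorem isBalancedOn_effType_pair [IsCMField L] (j : Fin n) (σ : L →+* ℂ) :
    IsBalancedOn (effType Φ s₀) ({(⟨j, σ⟩ : (_ : Fin n) × (L →+* ℂ)), ⟨j, conjugate σ⟩} : Finset _) :=
  CMTypeFamily.isBalancedOn_pair_of_bar
    (fun h => conjugate_ne_self' (Φ j) σ (congrArg (fun z : (_ : Fin n) × (L →+* ℂ) => z.2) h).symm)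
    (effType_conjugate_eq_bar Φ s₀ j σ)

omit [NumberField L] [IsGalois ℚ L] in
/-- A finite family of pairwise disjoint balanced PAIRS is a block union. [cite: Hazama2003GHCCM, Thm. 7.13–7.14 p. 650] -/
theorem isBlockUnion_biUnion_pair {α J : Type} [DecidableEq J] {Θ : J → CMType L} (R : Finset α) (f g : α → J)
    (hbal : ∀ a ∈ R, IsBalancedOn Θ {f a, g a}) (hfg : ∀ a ∈ R, f a ≠ g a)
    (hdis : ∀ a ∈ R, ∀ b ∈ R, a ≠ b → Disjoint ({f a, g a} : Finset J) {f b, g b}) :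
    IsBlockUnion Θ (R.biUnion fun a => {f a, g a}) := by
  induction R using Finset.induction_on with
  | empty => rw [Finset.biUnion_empty]; exact IsBlockUnion.empty
  | @insert a R haR ih =>
    have hd : Disjoint ({f a, g a} : Finset J) (R.biUnion fun b => {f b, g b}) := by
      rw [Finset.disjoint_biUnion_right]
      intro b hb
      exact hdis a (Finset.mem_insert_self a R) b (Finset.mem_insert_of_mem hb) fun h => haR (h ▸ hb)
    have hcard : ({f a, g a} : Finset J).card = 2 ∨ ({f a, g a} : Finset J).card = 4 :=
      Or.inl (Finset.card_pair (hfg a (Finset.mem_insert_self a R)))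
    refine (IsBlockUnion.cons (ih (fun b hb => hbal b (Finset.mem_insert_of_mem hb))
      (fun b hb => hfg b (Finset.mem_insert_of_mem hb))
      (fun b hb c hc => hdis b (Finset.mem_insert_of_mem hb) c (Finset.mem_insert_of_mem hc))) hd hcard
      (hbal a (Finset.mem_insert_self a R))).of_eq ?_
    rw [Finset.disjUnion_eq_union, Finset.biUnion_insert]

/-- **The index set `S ⊔ (all new indices)` of the enlarged product is a block union.** For `S` a set of
eigen-indices of `B = ⨁_{i<n} A_i` with balanced family of effective types there are new CM types
`Θ'_0, …, Θ'_{k-1}` of `L` such that, in the glued family `Φ ⊔ Θ'`, the set `S ⊔ ⊔_y ({y} × Hom(L, ℂ))` is a disjoint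
union of balanced blocks of size `2` or `4`: the blocks of `CMTypeFamily.exists_isBlockUnion_sum_elim` (placed at the
base embedding `s₀` of the new factors), their images under `γ_c` (`s₀ ∘ γ_c = s̄₀`; induced types stay block unions)
at `s̄₀`, and the conjugate pairs `{(y, σ), (y, σ̄)}`, `σ ≠ s₀, s̄₀`.
[cite: Hazama2003GHCCM, Thm. 7.13–7.14 p. 650, Thm. 8.2 p. 651] [cite: Milne2007TateFiniteFieldsAIM, Thm. 8.3] -/
theorem exists_isBlockUnion_glue [IsCMField L] {S : Finset ((_ : Fin n) × (L →+* ℂ))}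
    (hS : IsBalancedOn (effType Φ s₀) S) :
    ∃ (k : ℕ) (Θ' : Fin k → CMType L),
      IsBlockUnion (effType (glueType Φ Θ') s₀) (S.map (embO k) ∪ Finset.univ.map (embN n)) := by
  -- the block decomposition of the family of effective types on `S`
  let Θ : ↥S → CMType L := fun x => effType Φ s₀ x.1
  have huniv : (Finset.univ : Finset ↥S).map (Function.Embedding.subtype (· ∈ S)) = S := by
    ext x
    constructor
    · intro hx
      obtain ⟨a, -, rfl⟩ := Finset.mem_map.1 hx
      exact a.2
    · intro hx
      exact Finset.mem_map.2 ⟨⟨x, hx⟩, Finset.mem_univ _, rfl⟩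
  have hΘ : IsBalancedOn Θ Finset.univ := by
    have h := CMTypeFamily.isBalancedOn_map_iff (Θ := Θ) (Θ' := effType Φ s₀)
      (Function.Embedding.subtype (· ∈ S)) (fun _ => rfl) Finset.univ
    rw [huniv] at h
    exact h.1 hS
  obtain ⟨k, Θ', hB1, hB2⟩ := CMTypeFamily.exists_isBlockUnion_sum_elim Θ hΘ
  refine ⟨k, Θ', ?_⟩
  -- M₁ : the blocks of `S ⊔ (new factors at s₀)`
  have hinj : Function.Injective (Sum.elim (fun x : ↥S => inO k (L := L) x.1)
      (fun y : Fin k => inN n (⟨y, s₀⟩ : (_ : Fin k) × (L →+* ℂ)))) := by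
    rintro (x | y) (x' | y') h
    · exact congrArg Sum.inl (Subtype.ext (inO_injective k h))
    · exact absurd h (inO_ne_inN _ _)
    · exact absurd h.symm (inO_ne_inN _ _)
    · exact congrArg Sum.inr (congrArg Sigma.fst (inN_injective n h))
  let emb : (↥S ⊕ Fin k) ↪ ((_ : Fin (n + k)) × (L →+* ℂ)) := ⟨_, hinj⟩
  have emb_inl : ∀ x : ↥S, emb (Sum.inl x) = inO k x.1 := fun _ => rfl
  have emb_inr : ∀ y : Fin k, emb (Sum.inr y) = inN n ⟨y, s₀⟩ := fun _ => rfl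
  have hemb : ∀ t, effType (glueType Φ Θ') s₀ (emb t) = Sum.elim Θ Θ' t := by
    rintro (x | y)
    · rw [emb_inl]; exact effType_glue_inO Φ Θ' s₀ x.1
    · rw [emb_inr, Sum.elim_inr, effType_glue_inN, coe_twist_self, inducedCMType_id]
  have hM₁ : IsBlockUnion (effType (glueType Φ Θ') s₀) (Finset.univ.map emb) := hB2.map emb hemb
  -- M₂ : the new factors at `s̄₀`
  let emb₂ : Fin k ↪ ((_ : Fin (n + k)) × (L →+* ℂ)) :=
    ⟨fun y => inN n ⟨y, conjugate s₀⟩, fun y y' h => congrArg Sigma.fst (inN_injective n h)⟩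
  have emb₂_apply : ∀ y, emb₂ y = inN n ⟨y, conjugate s₀⟩ := fun _ => rfl
  have hM₂ : IsBlockUnion (effType (glueType Φ Θ') s₀) (Finset.univ.map emb₂) :=
    (hB1.induced (twist s₀ (conjugate s₀) : L →+* L)).map emb₂ fun y => effType_glue_inN Φ Θ' s₀ y (conjugate s₀)
  -- M₃ : the conjugate pairs of the new factors away from `s₀, s̄₀`
  let Rep : Finset ((_ : Fin k) × (L →+* ℂ)) :=
    Finset.univ.filter fun z => z.2 ∈ (Θ' z.1).1 ∧ z.2 ≠ s₀ ∧ z.2 ≠ conjugate s₀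
  have mem_Rep : ∀ z, z ∈ Rep ↔ z.2 ∈ (Θ' z.1).1 ∧ z.2 ≠ s₀ ∧ z.2 ≠ conjugate s₀ := fun z => by
    simp only [Rep, Finset.mem_filter, Finset.mem_univ, true_and]
  have hM₃ : IsBlockUnion (effType (glueType Φ Θ') s₀)
      (Rep.biUnion fun z => {inN n z, inN n ⟨z.1, conjugate z.2⟩}) := by
    refine isBlockUnion_biUnion_pair Rep (inN n) (fun z => inN n ⟨z.1, conjugate z.2⟩) ?_ ?_ ?_
    · intro z _
      exact isBalancedOn_effType_pair (glueType Φ Θ') s₀ (finSumFinEquiv (Sum.inr z.1)) z.2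
    · intro z _ h
      exact conjugate_ne_self' (Θ' z.1) z.2
        (congrArg (fun w : (_ : Fin k) × (L →+* ℂ) => w.2) (inN_injective n h)).symm
    · intro a ha b hb hab
      rw [mem_Rep] at ha hb
      rw [Finset.disjoint_left]
      intro z hz hz'
      simp only [Finset.mem_insert, Finset.mem_singleton] at hz hz'
      rcases hz with rfl | rfl <;> rcases hz' with h | h
      · exact hab (inN_injective n h)
      · have h' := inN_injective n h
        apply absurd ha.1
        rw [h']
        exact (CMTypeOps.mem_iff_conjugate_notMem _ _).1 hb.1
      · have h' := inN_injective n h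
        apply absurd hb.1
        rw [← h']
        exact (CMTypeOps.mem_iff_conjugate_notMem _ _).1 ha.1
      · have h' := inN_injective n h
        apply hab
        have h1 : (⟨a.1, conjugate a.2⟩ : (_ : Fin k) × (L →+* ℂ)).1 = (⟨b.1, conjugate b.2⟩ : (_ : Fin k) × (L →+* ℂ)).1 :=
          congrArg Sigma.fst h'
        have h2 : conjugate a.2 = conjugate b.2 := congrArg (fun w : (_ : Fin k) × (L →+* ℂ) => w.2) h'
        exact Sigma.ext h1 (heq_of_eq ((NumberField.ComplexEmbedding.involutive_conjugate L).injective h2))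
  -- the three pieces are pairwise disjoint
  have hd₁₂ : Disjoint (Finset.univ.map emb) (Finset.univ.map emb₂) := by
    rw [Finset.disjoint_left]
    intro z hz hz'
    obtain ⟨t, -, rfl⟩ := Finset.mem_map.1 hz
    obtain ⟨y, -, hy⟩ := Finset.mem_map.1 hz'
    rw [emb₂_apply] at hy
    rcases t with x | y'
    · rw [emb_inl] at hy; exact inO_ne_inN _ _ hy.symm
    · rw [emb_inr] at hy
      exact conjugate_ne_self' (Θ' y) s₀ (congrArg (fun w : (_ : Fin k) × (L →+* ℂ) => w.2) (inN_injective n hy))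
  have hd₃ : Disjoint ((Finset.univ.map emb).disjUnion (Finset.univ.map emb₂) hd₁₂)
      (Rep.biUnion fun z => {inN n z, inN n ⟨z.1, conjugate z.2⟩}) := by
    rw [Finset.disjoint_right]
    intro z hz hz'
    obtain ⟨a, ha, hza⟩ := Finset.mem_biUnion.1 hz
    rw [mem_Rep] at ha
    simp only [Finset.mem_insert, Finset.mem_singleton] at hza
    rcases Finset.mem_disjUnion.1 hz' with h1 | h2
    · obtain ⟨t, -, rfl⟩ := Finset.mem_map.1 h1
      rcases t with x | y
      · rw [emb_inl] at hza
        rcases hza with h | h <;> exact inO_ne_inN _ _ h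
      · rw [emb_inr] at hza
        rcases hza with h | h
        · exact ha.2.1 (congrArg (fun w : (_ : Fin k) × (L →+* ℂ) => w.2) (inN_injective n h)).symm
        · have h' : s₀ = conjugate a.2 := congrArg (fun w : (_ : Fin k) × (L →+* ℂ) => w.2) (inN_injective n h)
          exact ha.2.2 (by rw [h', NumberField.ComplexEmbedding.involutive_conjugate])
    · obtain ⟨y, -, rfl⟩ := Finset.mem_map.1 h2
      rw [emb₂_apply] at hza
      rcases hza with h | h
      · exact ha.2.2 (congrArg (fun w : (_ : Fin k) × (L →+* ℂ) => w.2) (inN_injective n h)).symm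
      · have h' : conjugate s₀ = conjugate a.2 :=
          congrArg (fun w : (_ : Fin k) × (L →+* ℂ) => w.2) (inN_injective n h)
        exact ha.2.1 ((NumberField.ComplexEmbedding.involutive_conjugate L).injective h').symm
  refine ((hM₁.disjUnion hM₂ hd₁₂).disjUnion hM₃ hd₃).of_eq ?_
  -- the union is `S ⊔ (all new indices)`
  ext z
  simp only [Finset.mem_disjUnion, Finset.mem_union, Finset.mem_map, Finset.mem_univ, true_and,
    Finset.mem_biUnion, Finset.mem_insert, Finset.mem_singleton]
  constructor
  · rintro ((⟨t, rfl⟩ | ⟨y, rfl⟩) | ⟨a, -, hz⟩)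
    · rcases t with x | y
      · exact Or.inl ⟨x.1, x.2, rfl⟩
      · exact Or.inr ⟨⟨y, s₀⟩, rfl⟩
    · exact Or.inr ⟨⟨y, conjugate s₀⟩, rfl⟩
    · rcases hz with rfl | rfl
      · exact Or.inr ⟨a, rfl⟩
      · exact Or.inr ⟨⟨a.1, conjugate a.2⟩, rfl⟩
  · rintro (⟨x, hx, rfl⟩ | ⟨⟨y, σ⟩, rfl⟩)
    · exact Or.inl (Or.inl ⟨Sum.inl ⟨x, hx⟩, rfl⟩)
    · by_cases h1 : σ = s₀
      · subst h1; exact Or.inl (Or.inl ⟨Sum.inr y, rfl⟩)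
      by_cases h2 : σ = conjugate s₀
      · subst h2; exact Or.inl (Or.inr ⟨y, rfl⟩)
      by_cases h3 : σ ∈ (Θ' y).1
      · exact Or.inr ⟨⟨y, σ⟩, (mem_Rep _).2 ⟨h3, h1, h2⟩, Or.inl rfl⟩
      · refine Or.inr ⟨⟨y, conjugate σ⟩, (mem_Rep _).2 ⟨(CMTypeOps.conjugate_mem_iff_notMem _ _).2 h3, ?_, ?_⟩,
          Or.inr ?_⟩
        · intro h; exact h2 (by rw [← h, NumberField.ComplexEmbedding.involutive_conjugate])
        · intro h; exact h1 ((NumberField.ComplexEmbedding.involutive_conjugate L).injective h)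
        · change inN n ⟨y, σ⟩ = inN n ⟨y, conjugate (conjugate σ)⟩
          rw [NumberField.ComplexEmbedding.involutive_conjugate]

end GlueIndex

section GlueGeometry

variable {L : Type} [Field L] {n k : ℕ}
variable (A : Fin n → AbelianVariety ℂ) (A' : Fin k → AbelianVariety ℂ)

/-- The glued family of abelian varieties `A ⊔ A'` on `Fin (n + k)`. [folklore] -/
def glueAV : Fin (n + k) → AbelianVariety ℂ := fun j => Sum.elim A A' (finSumFinEquiv.symm j)

/-- The projections of `B × B'` (`B = ⨁ A`, `B' = ⨁ A'`) onto the members of `A ⊔ A'`, on `Fin n ⊕ Fin k`. [folklore] -/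
def glueProj : ∀ s : Fin n ⊕ Fin k, (⨁ A).prod (⨁ A') ⟶ Sum.elim A A' s
  | Sum.inl i => AbelianVariety.fst _ _ ≫ biproduct.π A i
  | Sum.inr y => AbelianVariety.snd _ _ ≫ biproduct.π A' y

/-- The comparison homomorphism `φ : B × B' ⟶ ⨁ (A ⊔ A')` (an isomorphism, though only its existence as a
homomorphism is used). [folklore] -/
def glueHom : (⨁ A).prod (⨁ A') ⟶ ⨁ glueAV A A' := biproduct.lift fun j => glueProj A A' (finSumFinEquiv.symm j)

/-- `φ ≫ π_j` is the projection of `B × B'` onto the `j`-th member. [folklore] -/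
private theorem glueHom_π (j : Fin (n + k)) :
    glueHom A A' ≫ biproduct.π (glueAV A A') j = glueProj A A' (finSumFinEquiv.symm j) :=
  biproduct.lift_π _ _

variable {A A'}

/-- `(f ≫ g)^* = f^* ∘ g^*` on `Hᵈ` for homomorphisms of abelian varieties. [cite: HatcherAT2002, §3.2 Prop. 3.10] -/
private theorem map_comp_apply' {A₁ A₂ A₃ : AbelianVariety ℂ} {d : ℕ} (f : A₁ ⟶ A₂) (g : A₂ ⟶ A₃)
    (c : complexBetti A₃.X d) :
    complexBetti.map (f ≫ g).hom.hom.hom d c = complexBetti.map f.hom.hom.hom d (complexBetti.map g.hom.hom.hom d c) := by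
  change singularCohomology.map ℂ ℂ (Motives.AlgPoints.mapContinuous (L := ℂ) (f.hom.hom.hom ≫ g.hom.hom.hom)) d c = _
  rw [Motives.AlgPoints.mapContinuous_comp, singularCohomology.map_comp]
  rfl

/-- `φ^* π_j^* y = (pr ≫ π)^* y`. [cite: HatcherAT2002, §3.2 Prop. 3.10] -/
theorem map_glueHom_map_π (j : Fin (n + k)) {d : ℕ} (y : complexBetti (glueAV A A' j).X d) :
    complexBetti.map (glueHom A A').hom.hom.hom d (complexBetti.map (biproduct.π (glueAV A A') j).hom.hom.hom d y) =
      complexBetti.map (glueProj A A' (finSumFinEquiv.symm j)).hom.hom.hom d y := by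
  rw [← map_comp_apply', glueHom_π]
  rfl

variable (ι : ∀ i : Fin n, 𝓞 L →+* End (A i)) (ι' : ∀ y : Fin k, 𝓞 L →+* End (A' y))
  (θ : ∀ i : Fin n, L →+* Module.End ℂ (complexBetti (A i).X 1))
  (θ' : ∀ y : Fin k, L →+* Module.End ℂ (complexBetti (A' y).X 1))
  (v : ∀ i : Fin n, Module.Basis (L →+* ℂ) ℂ (complexBetti (A i).X 1))
  (v' : ∀ y : Fin k, Module.Basis (L →+* ℂ) ℂ (complexBetti (A' y).X 1))

/-- The glued `𝓞_L`-actions on `Fin n ⊕ Fin k`. [folklore] -/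
def glueEnd : ∀ s : Fin n ⊕ Fin k, 𝓞 L →+* End (Sum.elim A A' s)
  | Sum.inl i => ι i
  | Sum.inr y => ι' y

/-- The glued `L`-actions on `H¹`, on `Fin n ⊕ Fin k`. [folklore] -/
def glueAct : ∀ s : Fin n ⊕ Fin k, L →+* Module.End ℂ (complexBetti (Sum.elim A A' s).X 1)
  | Sum.inl i => θ i
  | Sum.inr y => θ' y

/-- The glued `H¹`-bases, on `Fin n ⊕ Fin k`. [folklore] -/
def glueVec : ∀ s : Fin n ⊕ Fin k, Module.Basis (L →+* ℂ) ℂ (complexBetti (Sum.elim A A' s).X 1)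
  | Sum.inl i => v i
  | Sum.inr y => v' y

/-- The glued `𝓞_L`-actions on `Fin (n + k)`. [folklore] -/
def glueEndFin : ∀ j : Fin (n + k), 𝓞 L →+* End (glueAV A A' j) := fun j => glueEnd ι ι' (finSumFinEquiv.symm j)

/-- The glued `L`-actions on `H¹`, on `Fin (n + k)`. [folklore] -/
def glueActFin : ∀ j : Fin (n + k), L →+* Module.End ℂ (complexBetti (glueAV A A' j).X 1) :=
  fun j => glueAct θ θ' (finSumFinEquiv.symm j)

/-- The glued `H¹`-bases on `Fin (n + k)`. [folklore] -/
def glueVecFin : ∀ j : Fin (n + k), Module.Basis (L →+* ℂ) ℂ (complexBetti (glueAV A A' j).X 1) :=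
  fun j => glueVec v v' (finSumFinEquiv.symm j)

variable {ι ι' θ θ' v v'} {Φ : Fin n → CMType L} {Θ' : Fin k → CMType L}

/-- The members of `A ⊔ A'` realise the glued types `Φ ⊔ Θ'`. [cite: Shimura1998, §6.2 Thm. 3] -/
theorem glue_isCMTypeRealisation [NumberField L] (hA : ∀ i, IsCMTypeRealisation (Φ i) (A i) (ι i) (θ i))
    (hA' : ∀ y, IsCMTypeRealisation (Θ' y) (A' y) (ι' y) (θ' y)) :
    ∀ s : Fin n ⊕ Fin k, IsCMTypeRealisation (Sum.elim Φ Θ' s) (Sum.elim A A' s) (glueEnd ι ι' s) (glueAct θ θ' s)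
  | Sum.inl i => hA i
  | Sum.inr y => hA' y

/-- The members of `A ⊔ A'` on `Fin (n + k)` realise `glueType Φ Θ'`. [cite: Shimura1998, §6.2 Thm. 3] -/
theorem glueFin_isCMTypeRealisation [NumberField L] (hA : ∀ i, IsCMTypeRealisation (Φ i) (A i) (ι i) (θ i))
    (hA' : ∀ y, IsCMTypeRealisation (Θ' y) (A' y) (ι' y) (θ' y)) (j : Fin (n + k)) :
    IsCMTypeRealisation (glueType Φ Θ' j) (glueAV A A' j) (glueEndFin ι ι' j) (glueActFin θ θ' j) :=
  glue_isCMTypeRealisation hA hA' _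

/-- The glued bases are eigenbases. [cite: Milne2020HodgeClassesAV, 1.2 (a)] -/
theorem glue_eigen (hv : ∀ i σ (c : L), θ i c (v i σ) = σ c • v i σ)
    (hv' : ∀ y σ (c : L), θ' y c (v' y σ) = σ c • v' y σ) :
    ∀ (s : Fin n ⊕ Fin k) (σ : L →+* ℂ) (c : L), glueAct θ θ' s c (glueVec v v' s σ) = σ c • glueVec v v' s σ
  | Sum.inl i => hv i
  | Sum.inr y => hv' y

/-- The glued bases on `Fin (n + k)` are eigenbases. [cite: Milne2020HodgeClassesAV, 1.2 (a)] -/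
theorem glueFin_eigen (hv : ∀ i σ (c : L), θ i c (v i σ) = σ c • v i σ)
    (hv' : ∀ y σ (c : L), θ' y c (v' y σ) = σ c • v' y σ) (j : Fin (n + k)) (σ : L →+* ℂ) (c : L) :
    glueActFin θ θ' j c (glueVecFin v v' j σ) = σ c • glueVecFin v v' j σ :=
  glue_eigen hv hv' _ σ c

variable (v v')

/-- The pulled-back basis classes `pr^* v_{s,σ}` on `B × B'`, on `Fin n ⊕ Fin k`. [folklore] -/
def glueClass (s : Fin n ⊕ Fin k) (σ : L →+* ℂ) : complexBetti ((⨁ A).prod (⨁ A')).X 1 :=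
  complexBetti.map (glueProj A A' s).hom.hom.hom 1 (glueVec v v' s σ)

/-- At an old index: `pr_B^* π_i^* v_{i,σ}`. [folklore] -/
private theorem glueClass_inl (i : Fin n) (σ : L →+* ℂ) :
    glueClass v v' (Sum.inl i) σ = complexBetti.map (AbelianVariety.fst (⨁ A) (⨁ A')).hom.hom.hom 1
      (complexBetti.map (biproduct.π A i).hom.hom.hom 1 (v i σ)) :=
  map_comp_apply' _ _ _

/-- At a new index: `pr_{B'}^* π_y^* v'_{y,σ}`. [folklore] -/
private theorem glueClass_inr (y : Fin k) (σ : L →+* ℂ) :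
    glueClass v v' (Sum.inr y) σ = complexBetti.map (AbelianVariety.snd (⨁ A) (⨁ A')).hom.hom.hom 1
      (complexBetti.map (biproduct.π A' y).hom.hom.hom 1 (v' y σ)) :=
  map_comp_apply' _ _ _

/-- **An eigenbasis of `H¹(⨁ A)` from eigenbases of the factors**: `w_{(i,σ)} = π_i^* v_{i,σ}` satisfies
`(⊕_i ι_i(c_i))^* w_{(i,σ)} = σ(c_i) w_{(i,σ)}`. [cite: Milne2020HodgeClassesAV, 1.1–1.2 (a)] -/
theorem biproductBasis_eigen [NumberField L] {N : ℕ} {Ψ : Fin N → CMType L} {C : Fin N → AbelianVariety ℂ}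
    {κ : ∀ j : Fin N, 𝓞 L →+* End (C j)} {η : ∀ j : Fin N, L →+* Module.End ℂ (complexBetti (C j).X 1)}
    (hC : ∀ j, IsCMTypeRealisation (Ψ j) (C j) (κ j) (η j))
    (u : ∀ j : Fin N, Module.Basis (L →+* ℂ) ℂ (complexBetti (C j).X 1))
    (hu : ∀ j σ (c : L), η j c (u j σ) = σ c • u j σ)
    {w : Module.Basis ((_ : Fin N) × (L →+* ℂ)) ℂ (complexBetti (⨁ C).X 1)}
    (hw : ∀ x, w x = complexBetti.map (biproduct.π C x.1).hom.hom.hom 1 (u x.1 x.2)) :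
    ∀ (c : Fin N → 𝓞 L) (x : (_ : Fin N) × (L →+* ℂ)),
      complexBetti.map (biproduct.map fun j => κ j (c j)).hom.hom.hom 1 (w x) = x.2 ((c x.1 : 𝓞 L) : L) • w x := by
  intro c x
  have hθ : complexBetti.map (κ x.1 (c x.1)).hom.hom.hom 1 (u x.1 x.2) = x.2 ((c x.1 : 𝓞 L) : L) • u x.1 x.2 := by
    rw [show complexBetti.map (κ x.1 (c x.1)).hom.hom.hom 1 (u x.1 x.2) =
      (complexBetti.map (κ x.1 (c x.1)).hom.hom.hom 1).hom (u x.1 x.2) from rfl, (hC x.1).2.2.1 (c x.1)]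
    exact hu x.1 x.2 _
  rw [hw x, map_biproductMap_map_π, hθ, map_smul]

/-! #### Finite biproducts: dimension and CM-type (standard bookkeeping) -/

open Motives.AbelianVariety in
/-- `⨁_{Fin (m+1)} f ≅ f 0 × ⨁_{Fin m} (f ∘ succ)`. [cite: MumfordAV1970, §19] -/
private theorem biproduct_succ_split {m : ℕ} (f : Fin (m + 1) → AbelianVariety ℂ) :
    ∃ (h : (⨁ f) ⟶ (f 0).prod (⨁ (f ∘ Fin.succ))) (g : (f 0).prod (⨁ (f ∘ Fin.succ)) ⟶ ⨁ f),
      h ≫ g = 𝟙 _ ∧ g ≫ h = 𝟙 _ := by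
  refine ⟨prodLift (biproduct.π f 0) (biproduct.lift fun i => biproduct.π f i.succ),
    biproduct.lift fun j => Fin.cases (fst _ _) (fun i => snd _ _ ≫ biproduct.π (f ∘ Fin.succ) i) j, ?_, ?_⟩
  · refine biproduct.hom_ext _ _ fun j => ?_
    rw [Category.assoc, biproduct.lift_π, Category.id_comp]
    refine Fin.cases ?_ (fun i => ?_) j
    · exact prodLift_fst _ _
    · change prodLift _ _ ≫ snd _ _ ≫ biproduct.π (f ∘ Fin.succ) i = biproduct.π f i.succ
      rw [← Category.assoc, prodLift_snd, biproduct.lift_π]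
  · refine prod_hom_ext (by rw [Category.assoc, prodLift_fst, biproduct.lift_π, Category.id_comp]; rfl) ?_
    rw [Category.assoc, prodLift_snd, Category.id_comp]
    refine biproduct.hom_ext _ _ fun i => ?_
    rw [Category.assoc, biproduct.lift_π]
    exact biproduct.lift_π _ _

open Motives.AbelianVariety in
/-- The empty biproduct has dimension `0`. [cite: MumfordAV1970, §19] -/
private theorem dim_biproduct_fin_zero (f : Fin 0 → AbelianVariety ℂ) : (⨁ f).dim = 0 := by
  by_contra h
  have hid : (𝟙 (⨁ f) : ⨁ f ⟶ ⨁ f) = 0 := biproduct.hom_ext _ _ fun j => Fin.elim0 j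
  exact not_isIsogeny_zero_of_dim_pos (Nat.pos_of_ne_zero h) (hid ▸ isIsogeny_id (⨁ f))

open Motives.AbelianVariety in
/-- `dim (⨁_{Fin m} f) = Σ_i dim (f i)`. [cite: MumfordAV1970, §19] -/
theorem dim_biproduct_fin {m : ℕ} : ∀ f : Fin m → AbelianVariety ℂ, (⨁ f).dim = ∑ i, (f i).dim := by
  induction m with
  | zero => intro f; rw [dim_biproduct_fin_zero, Finset.univ_eq_empty, Finset.sum_empty]
  | succ m ih =>
    intro f
    obtain ⟨h, g, hhg, hgh⟩ := biproduct_succ_split f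
    have hh : IsIsogeny h := isIsogeny_of_comp_eq_of_comp_eq (isIsogeny_id _) (isIsogeny_id _) hgh hhg
    rw [dim_eq_of_isIsogeny hh, dim_prod, ih (f ∘ Fin.succ), Fin.sum_univ_succ]
    rfl

/-- **A finite biproduct of abelian varieties of CM-type is of CM-type** (Milne 1999 §2 p. 54; the tree's
`isOfCMType_prod_iff` iterated along `⨁_{Fin (m+1)} f ≅ f 0 × ⨁ (f ∘ succ)`). [cite: Milne1999LefschetzClasses, §2 p. 54] -/
theorem isOfCMType_biproduct_fin : ∀ {m : ℕ} (f : Fin m → AbelianVariety ℂ), (∀ i, Milne1999.IsOfCMType (f i)) →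
    Milne1999.IsOfCMType (⨁ f)
  | 0, f, _ => Milne1999.isOfCMType_of_dim_eq_zero (dim_biproduct_fin_zero f)
  | _ + 1, f, hf => by
    obtain ⟨h, g, hhg, -⟩ := biproduct_succ_split f
    exact (Milne1999.isOfCMType_prod_iff.2 ⟨hf 0, isOfCMType_biproduct_fin (f ∘ Fin.succ) fun i => hf i.succ⟩).of_comp_eq_id
      h g hhg

end GlueGeometry

/-! ### §4 The balanced monomials of `⨁ A` are algebraic; the Hodge conjecture for `⨁ A` -/

section Main

variable {L : Type} [Field L] [NumberField L] [IsCMField L] [IsGalois ℚ L]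
variable {n : ℕ} {Φ : Fin n → CMType L} {A : Fin n → AbelianVariety ℂ} {ι : ∀ i : Fin n, 𝓞 L →+* End (A i)}
  {θ : ∀ i : Fin n, L →+* Module.End ℂ (complexBetti (A i).X 1)}

/-- **KEY (Hazama's `2`-dominatedness, geometric form): every balanced cup monomial of `B = ⨁_{i<n} A_i` is
algebraic, granted the Hodge conjecture in codimension two for CM abelian varieties.** For realisations `A_i` of CM
types `Φ_i` of one Galois CM field `L`, an eigenbasis `w_{(i,σ)} = π_i^* v_{i,σ}` of `H¹(B)` and a Galois-balanced
`2m`-set `S` of eigen-indices, `w_S ∈ Nᵐ H^{2m}(B)`: enlarge `B` by auxiliary CM factors `A'_y` realising the new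
types of `exists_isBlockUnion_glue` (`exists_isCMTypeRealisation`), so that on `B'' = ⨁ (A ⊔ A')` the monomial over
`S ⊔ (all new indices)` is a product of classes in `B¹ ⊗ ℂ` and `B² ⊗ ℂ` of the CM abelian variety `B''`, hence
algebraic (`cupMonomial_mem_algebraicClasses_of_isBlockUnion`); its pull-back along `φ : B × B' → B''` is
`± pr_B^* w_S ∪ pr_{B'}^* Ω` with `Ω ≠ 0` the top monomial of `B'`, and the Gysin contraction along `pr_B` returns
(a non-zero multiple of) `w_S` (`mem_algebraicClasses_of_cupProduct_map_fst_map_snd`).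
[cite: Hazama2003GHCCM, Thm. 7.14 p. 650, Thm. 8.2 p. 651, Thm. 8.3 p. 655] [cite: Milne2007TateFiniteFieldsAIM, Thm. 8.3, Thm. 8.5] -/
theorem cupMonomial_mem_algebraicClasses_of_mem_pohlmannSetsAlg
    (hA : ∀ i, IsCMTypeRealisation (Φ i) (A i) (ι i) (θ i)) (h2 : ∀ X : AbelianVariety ℂ, CMHodgeCodimTwoHypothesisAt X)
    [LinearOrder ((_ : Fin n) × (L →+* ℂ))]
    (v : ∀ i : Fin n, Module.Basis (L →+* ℂ) ℂ (complexBetti (A i).X 1))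
    (hv : ∀ i σ (c : L), θ i c (v i σ) = σ c • v i σ)
    {w : Module.Basis ((_ : Fin n) × (L →+* ℂ)) ℂ (complexBetti (⨁ A).X 1)}
    (hw : ∀ x, w x = complexBetti.map (biproduct.π A x.1).hom.hom.hom 1 (v x.1 x.2))
    {m : ℕ} (S : Set.powersetCard ((_ : Fin n) × (L →+* ℂ)) (2 * m))
    (hS : (S : Finset _) ∈ pohlmannSetsAlg (K := fun _ => L) Φ m) :
    cupMonomial w (2 * m) S ∈ algebraicClasses (⨁ A).X m := by
  obtain ⟨s₀⟩ : Nonempty (L →+* ℂ) := inferInstance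
  -- (1) blocks on the glued index set
  have hSbal : IsBalancedOn (effType Φ s₀) (S : Finset _) := (isGaloisBalancedAlg_iff_isBalancedOn Φ s₀ _).1 hS.2
  obtain ⟨k, Θ', hT⟩ := exists_isBlockUnion_glue Φ s₀ hSbal
  -- (2) realise the new types, with eigenbases
  have hex : ∀ y, ∃ (A' : AbelianVariety ℂ) (ι' : 𝓞 L →+* End A') (θ' : L →+* Module.End ℂ (complexBetti A'.X 1)),
      IsCMTypeRealisation (Θ' y) A' ι' θ' := fun y => exists_isCMTypeRealisation (Θ' y)
  choose A' ι' θ' hA' using hex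
  have hvex : ∀ y, ∃ v' : Module.Basis (L →+* ℂ) ℂ (complexBetti (A' y).X 1),
      ∀ σ (c : L), θ' y c (v' σ) = σ c • v' σ := fun y => by
    obtain ⟨β, hβ⟩ := exists_ringOfIntegers_separating_embeddings (F := L)
    exact exists_eigenbasis (hA' y) hβ
  choose v' hv' using hvex
  -- (3) the glued family `A'' = A ⊔ A'` on `Fin (n + k)`
  have hA'' : ∀ j, IsCMTypeRealisation (glueType Φ Θ' j) (glueAV A A' j) (glueEndFin ι ι' j) (glueActFin θ θ' j) :=
    glueFin_isCMTypeRealisation hA hA'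
  obtain ⟨w'', hw''⟩ := exists_biproductBasis_sigma (glueAV A A') (glueVecFin v v')
  obtain ⟨w', hw'⟩ := exists_biproductBasis_sigma A' v'
  have hCM'' : Milne1999.IsOfCMType (⨁ glueAV A A') := isOfCMType_biproduct_fin _ fun j => (hA'' j).isOfCMType
  letI : LinearOrder ((_ : Fin (n + k)) × (L →+* ℂ)) := LinearOrder.lift' (Fintype.equivFin _) (Equiv.injective _)
  letI : LinearOrder ((_ : Fin k) × (L →+* ℂ)) := LinearOrder.lift' (Fintype.equivFin _) (Equiv.injective _)
  -- (4) cardinalities: `#(new indices) = k · [L:ℚ] = 2 dim B'`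
  set dN := (⨁ A').dim with hdN
  have hfin : Module.finrank ℚ L / 2 * 2 = Module.finrank ℚ L := by
    have := IsTotallyComplex.finrank (K := L); omega
  have hdimA' : ∀ y, (A' y).dim = Module.finrank ℚ L / 2 := fun y => Motives.schemeDim_eq_holds (hA' y).1
  have hdN' : dN = k * (Module.finrank ℚ L / 2) := by
    rw [hdN, dim_biproduct_fin, Finset.sum_congr rfl fun y _ => hdimA' y, Finset.sum_const, Finset.card_univ,
      Fintype.card_fin, smul_eq_mul]
  have hcardFull : (Finset.univ : Finset ((_ : Fin k) × (L →+* ℂ))).card = 2 * dN := by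
    rw [Finset.card_univ, Fintype.card_sigma, Finset.sum_const, Finset.card_univ, Fintype.card_fin, smul_eq_mul,
      NumberField.Embeddings.card, hdN']
    conv_lhs => rw [← hfin]
    ring
  have hcardN : ((Finset.univ : Finset ((_ : Fin k) × (L →+* ℂ))).map (embN n)).card = 2 * dN := by
    rw [Finset.card_map, hcardFull]
  have hcardS : (S.val.map (embO k)).card = 2 * m := by
    rw [Finset.card_map]; exact Set.powersetCard.mem_iff.1 S.2
  let S'' : Set.powersetCard ((_ : Fin (n + k)) × (L →+* ℂ)) (2 * m) := Set.powersetCard.ofCard hcardS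
  let N'' : Set.powersetCard ((_ : Fin (n + k)) × (L →+* ℂ)) (2 * dN) := Set.powersetCard.ofCard hcardN
  let FULL : Set.powersetCard ((_ : Fin k) × (L →+* ℂ)) (2 * dN) := Set.powersetCard.ofCard hcardFull
  have hdisj : Disjoint (S.val.map (embO k)) (Finset.univ.map (embN n)) := disjoint_map_embO_map_embN _ _
  have hcardT : (S.val.map (embO k) ∪ Finset.univ.map (embN n)).card = 2 * (m + dN) := by
    rw [Finset.card_union_of_disjoint hdisj, hcardS, hcardN]; ring
  let T'' : Set.powersetCard ((_ : Fin (n + k)) × (L →+* ℂ)) (2 * (m + dN)) := Set.powersetCard.ofCard hcardT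
  -- (5) the monomial over `T'' = S ⊔ NEW` is algebraic on `B''`
  have halg'' : cupMonomial w'' (2 * (m + dN)) T'' ∈ algebraicClasses (⨁ glueAV A A').X (m + dN) :=
    cupMonomial_mem_algebraicClasses_of_isBlockUnion hA'' hCM'' (h2 _) s₀
      (biproductBasis_eigen hA'' (glueVecFin v v') (glueFin_eigen hv hv') hw'') hT (m + dN) T'' rfl
  -- (6) pull back along `φ : B × B' → B''`
  have hpull := map_mem_algebraicClasses_of_abelianVariety
    (Motives.AbelianVariety.isSmoothProjective_holds (A := (⨁ A).prod (⨁ A'))) (⨁ glueAV A A')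
    (glueHom A A').hom.hom.hom halg''
  rw [complexBetti_map_cupMonomial] at hpull
  set u : ((_ : Fin (n + k)) × (L →+* ℂ)) → complexBetti ((⨁ A).prod (⨁ A')).X 1 :=
    fun x => complexBetti.map (glueHom A A').hom.hom.hom 1 (w'' x) with hu
  have hu_form : ∀ x, u x = glueClass v v' (finSumFinEquiv.symm x.1) x.2 := fun x => by
    rw [hu]
    change complexBetti.map (glueHom A A').hom.hom.hom 1 (w'' x) = _
    rw [hw'' x, map_glueHom_map_π]
    rfl
  have hu_old : ∀ x, u (embO k x) = complexBetti.map (AbelianVariety.fst (⨁ A) (⨁ A')).hom.hom.hom 1 (w x) := fun x => by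
    rw [hu_form, hw x]
    change glueClass v v' (finSumFinEquiv.symm (finSumFinEquiv (Sum.inl x.1))) x.2 = _
    rw [Equiv.symm_apply_apply, glueClass_inl]
  have hu_new : ∀ z, u (embN n z) = complexBetti.map (AbelianVariety.snd (⨁ A) (⨁ A')).hom.hom.hom 1 (w' z) := fun z => by
    rw [hu_form, hw' z]
    change glueClass v v' (finSumFinEquiv.symm (finSumFinEquiv (Sum.inr z.1))) z.2 = _
    rw [Equiv.symm_apply_apply, glueClass_inr]
  -- (7) split `u_{T''} = ± (u_{S''} ∪ u_{N''}) = ± (pr_B^* w_S ∪ pr_{B'}^* Ω)`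
  obtain ⟨ε₁, h₁⟩ := exists_cupMonomial_eq_smul_cupProduct u (two_mul_add_two_mul m dN) S'' N'' hdisj T''
    (Finset.disjUnion_eq_union _ _ hdisj).symm
  obtain ⟨ε₂, h₂⟩ := exists_cupMonomial_map_eq_smul u (embO k) S S'' rfl
  obtain ⟨ε₃, h₃⟩ := exists_cupMonomial_map_eq_smul u (embN n) FULL N'' rfl
  have hS_eq : cupMonomial (u ∘ embO k) (2 * m) S =
      complexBetti.map (AbelianVariety.fst (⨁ A) (⨁ A')).hom.hom.hom (2 * m) (cupMonomial w (2 * m) S) := by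
    rw [complexBetti_map_cupMonomial]
    exact congrArg (fun f => cupMonomial f (2 * m) S) (funext fun x => hu_old x)
  have hN_eq : cupMonomial (u ∘ embN n) (2 * dN) FULL =
      complexBetti.map (AbelianVariety.snd (⨁ A) (⨁ A')).hom.hom.hom (2 * dN) (cupMonomial w' (2 * dN) FULL) := by
    rw [complexBetti_map_cupMonomial]
    exact congrArg (fun f => cupMonomial f (2 * dN) FULL) (funext fun z => hu_new z)
  have hΩ : cupMonomial w' (2 * dN) FULL ≠ 0 := by
    obtain ⟨b, hb⟩ := exists_monomialBasis w' (2 * dN)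
    have hbF : b FULL = cupMonomial w' (2 * dN) FULL := hb FULL
    rw [← hbF]
    exact b.ne_zero FULL
  rw [h₁, h₂, h₃, hS_eq, hN_eq, units_smul_eq_cast_smul ε₂, units_smul_eq_cast_smul ε₃, LinearMap.map_smul₂,
    map_smul, smul_smul] at hpull
  have hc : ((ε₂ : ℤ) : ℂ) * ((ε₃ : ℤ) : ℂ) ≠ 0 :=
    mul_ne_zero (Int.cast_ne_zero.2 ε₂.ne_zero) (Int.cast_ne_zero.2 ε₃.ne_zero)
  have hmem := Submodule.smul_mem _ (((ε₂ : ℤ) : ℂ) * ((ε₃ : ℤ) : ℂ))⁻¹ (mem_of_units_smul_mem _ ε₁ hpull)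
  rw [smul_smul, inv_mul_cancel₀ hc, one_smul] at hmem
  -- (8) contract along `pr_B`
  exact mem_algebraicClasses_of_cupProduct_map_fst_map_snd (⨁ A) (⨁ A') hΩ hmem

/-- **The Hodge conjecture for products of CM abelian varieties over one Galois CM field follows from the Hodge
conjecture in codimension two for CM abelian varieties** (the product step of Hazama 2002 Thm. 7.6 / 2003 Thm. 8.3 =
Milne 2007 Thm. 8.5, through Thm. 8.3 in its correct ℤ-linear form): if every complex abelian variety of CM-type
satisfies the Hodge conjecture in codimension `2`, then for realisations `A_i` (`i < n`) of CM types `Φ_i` of a Galois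
CM field `L` the abelian variety `⨁ A_i` satisfies the Hodge conjecture — `Bᵐ ⊗ ℂ` is spanned by the balanced
monomials (Pohlmann, `hodgeClassSpan_biproduct_eq_span_image`), each of which is algebraic
(`cupMonomial_mem_algebraicClasses_of_mem_pohlmannSetsAlg`). [cite: Hazama2003GHCCM, Thm. 8.2 p. 651 and Thm. 8.3 p. 655]
[cite: Hazama2002GHCCM, Thm. 7.6] [cite: Milne2007TateFiniteFieldsAIM, §8.2 Thm. 8.3 and Thm. 8.5] -/
theorem hodgeConjectureFor_biproduct_of_codimTwo (hA : ∀ i, IsCMTypeRealisation (Φ i) (A i) (ι i) (θ i))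
    (h2 : ∀ X : AbelianVariety ℂ, CMHodgeCodimTwoHypothesisAt X) : HodgeConjectureFor (⨁ A).dim (⨁ A).X := by
  letI : LinearOrder ((_ : Fin n) × (L →+* ℂ)) := LinearOrder.lift' (Fintype.equivFin _) (Equiv.injective _)
  have hvex : ∀ i, ∃ v : Module.Basis (L →+* ℂ) ℂ (complexBetti (A i).X 1), ∀ σ (c : L), θ i c (v σ) = σ c • v σ :=
    fun i => by
      obtain ⟨β, hβ⟩ := exists_ringOfIntegers_separating_embeddings (F := L)
      exact exists_eigenbasis (hA i) hβ
  choose v hv using hvex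
  obtain ⟨w, hw⟩ := exists_biproductBasis_sigma A v
  have hweig := biproductBasis_eigen hA v hv hw
  refine ⟨nonempty_hodgeModel_holds Motives.AbelianVariety.isSmoothProjective_holds, fun p c hcQ hcH => ?_⟩
  obtain ⟨b, hb⟩ := exists_monomialBasis w (2 * p)
  have hb' : ∀ s, b s = cupMonomial w (2 * p) s := hb
  have hc : c ∈ hodgeClassSpan (⨁ A).dim (⨁ A).X p := Submodule.subset_span ⟨hcQ, hcH⟩
  rw [hodgeClassSpan_biproduct_eq_span_image (K := fun _ => L) hA hweig hb'] at hc
  refine (Submodule.span_le.2 ?_) hc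
  rintro _ ⟨s, hs, rfl⟩
  rw [hb' s]
  exact cupMonomial_mem_algebraicClasses_of_mem_pohlmannSetsAlg hA h2 v hv hw s hs

end Main

end CMCodimTwo

end Literature.AlgebraicGeometry.HodgeTheory

end
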